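import Summits.CriticalPhenomena.CardyFormulaZ2.Theorems.CardyUSTContinuationKirchhoffExtremalLengthConductanceBound
import Literature.Probability.LatticeModels.MeshDomainJordan
import Literature.Probability.LatticeModels.SquareTilingModulusLimsup

/-!
# The potential of `Ω_δ` between the discrete arcs and its interior harmonicity
# (G02 discretisation: `meshDomain` / `discreteArc`, every Jordan domain)

Support file for `KirchhoffExtremalLength` (route CardyUSTContinuation of `CardyFormulaZ2`, item
stmt-CriticalPhenomena-11234), towards `G02ModulusConvergence` (`…Defs.lean`). Transposition of
[GP19] §3.2 / §4.1 (the tree's `SquareTiling.exists_potential`, `isLatticeHarmonicOn_boxInterior`,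
`eventually_adj_nearestSite`, `eventually_axisEdges_mem`) from the Georgakopoulos–Panagiotis
discretisation to `Ω_δ = discreteDomainGraph Ω δ` with the discrete arcs `discreteArc`:

* `exists_g02Potential`: the Dirichlet-principle minimiser `h : ℤ² → [0,1]`, `h ≡ 1` on
  `A_δ = discreteArc Ω δ (ab)`, `h ≡ 0` on `B_δ = discreteArc Ω δ (cd)`, harmonic for `Ω_δ` off
  `A_δ ∪ B_δ`, with energy `𝒞(A_δ ↔ B_δ; Ω_δ)`;
* `exists_forall_isLatticeHarmonicOn_boxInterior`: for a compact `K ⊆ Ω` and all small meshes, any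
  such `h` is lattice harmonic on the interior of every lattice box whose rescaled closed square
  lies in `K` — the input format of `…G02Interior.lean`. The point is that the lattice points of
  `K` belong to `meshDomain Ω δ` for small `δ`, for EVERY Jordan domain
  (`JordanDomain.exists_forall_mem_meshDomain_and_reachable`, `MeshDomainJordan.lean`);
* `exists_forall_adj_of_mem`, `eventually_adj_nearestSite'`, `eventually_axisEdges_mem'`: the four
  lattice edges at the lattice points of a compact subset are edges of `Ω_δ` for small `δ`.
-/

noncomputable section

namespace Summit.CriticalPhenomena.CardyFormulaZ2.Theorems

namespace KirchhoffSlope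

open Set Metric Filter Topology
open Literature.Probability.LatticeModels Literature.Probability.LatticeModels.SquareTiling
open Literature.Probability.RandomPlanarGeometry

variable {Ω : Set ℂ} {δ : ℝ}

/-! ### The potential -/

open Classical in
/-- The filtered neighbour finset of `x` is its neighbourhood in `Ω_δ`. [folklore] -/
theorem mem_filter_neighborFinset_discreteDomainGraph_iff (x y : Site 2) :
    y ∈ ((zdGraph 2).neighborFinset x).filter (fun y => (discreteDomainGraph Ω δ).Adj x y) ↔
      (discreteDomainGraph Ω δ).Adj x y := by
  rw [Finset.mem_filter, SimpleGraph.mem_neighborFinset]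
  exact ⟨fun h => h.2, fun h => ⟨meshGraph_le_zdGraph Ω δ (discreteDomainGraph_le_meshGraph Ω δ h), h⟩⟩

open Classical in
/-- **The potential of `Ω_δ` between the discrete arcs** ([GP19], §3.2, for the
`meshDomain`/`discreteArc` discretisation): for a conformal rectangle `R` and a mesh `δ > 0` at
which the discrete arcs `A_δ`, `B_δ` of `(ab)`, `(cd)` are disjoint, there is `h : ℤ² → [0, 1]`
with `h ≡ 1` on `A_δ`, `h ≡ 0` on `B_δ`, harmonic for `Ω_δ` at every vertex outside `A_δ ∪ B_δ`,
whose energy is the effective conductance `𝒞(A_δ ↔ B_δ; Ω_δ)`.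
[cite: GeorgakopoulosPanagiotis2019, §3.2] -/
theorem exists_g02Potential (R : ConformalRectangle) (hδ : 0 < δ)
    (hdisj : discreteArc R.carrier δ (R.arc 0) ∩ discreteArc R.carrier δ (R.arc 2) = ∅) :
    ∃ h : Site 2 → ℝ,
      (discreteArc R.carrier δ (R.arc 0)).EqOn h 1 ∧ (discreteArc R.carrier δ (R.arc 2)).EqOn h 0 ∧
      (∀ x, h x ∈ Icc (0 : ℝ) 1) ∧
      networkEnergy (discreteDomainGraph R.carrier δ) 1 h =
        effectiveConductance (discreteDomainGraph R.carrier δ) 1 (discreteArc R.carrier δ (R.arc 0))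
          (discreteArc R.carrier δ (R.arc 2)) ∧
      ∀ x, x ∉ discreteArc R.carrier δ (R.arc 0) → x ∉ discreteArc R.carrier δ (R.arc 2) →
        ∑ y ∈ ((zdGraph 2).neighborFinset x).filter (fun y => (discreteDomainGraph R.carrier δ).Adj x y),
          (h y - h x) = 0 :=
  exists_harmonic_minimiser (edgeSet_discreteDomainGraph_finite R.isBounded hδ)
    (Set.disjoint_iff_inter_eq_empty.2 hdisj) _
    fun x y => mem_filter_neighborFinset_discreteDomainGraph_iff x y

/-! ### Interior harmonicity -/

/-- If the rescaled closed square of a lattice box lies in `Ω` and all its lattice points are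
vertices of `Ω_δ`, then the four lattice edges at every interior point of the box are edges of
`Ω_δ`. [cite: GeorgakopoulosPanagiotis2019, §4.1] -/
theorem discreteDomainGraph_adj_of_box (hδ : 0 < δ) {a : Site 2} {N : ℕ}
    (hΩ : Complex.Rectangle (meshPoint δ a) (meshPoint δ (a + ![(N : ℤ), (N : ℤ)])) ⊆ Ω)
    (hdom : ∀ x : Site 2,
      meshPoint δ x ∈ Complex.Rectangle (meshPoint δ a) (meshPoint δ (a + ![(N : ℤ), (N : ℤ)])) →
        x ∈ meshDomain Ω δ)
    {x : Site 2} (hx : x ∈ boxInterior a N) (k : Fin 4) :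
    (discreteDomainGraph Ω δ).Adj x (x + cornerUnit k) := by
  obtain ⟨hx0, hx0', hx1, hx1'⟩ := hx
  have hxI : x 0 ∈ Icc (a 0) (a 0 + N) ∧ x 1 ∈ Icc (a 1) (a 1 + N) := ⟨⟨by omega, by omega⟩, ⟨by omega, by omega⟩⟩
  have hnI : (x + cornerUnit k) 0 ∈ Icc (a 0) (a 0 + N) ∧ (x + cornerUnit k) 1 ∈ Icc (a 1) (a 1 + N) := by
    fin_cases k <;> simp [cornerUnit] <;> omega
  have hxR := meshPoint_mem_rectangle_of_mem_Icc hδ.le hxI.1 hxI.2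
  have hkR := meshPoint_mem_rectangle_of_mem_Icc hδ.le hnI.1 hnI.2
  refine discreteDomainGraph_adj_iff.2 ⟨meshGraph_adj_iff.2 ⟨cSrc_mem_edgeSet (x, k), ?_⟩, hdom _ hxR, hdom _ hkR⟩
  exact (((convex_rectangle _ _).segment_subset hxR hkR).trans hΩ).trans subset_closure

/-- A vertex all four of whose lattice edges are edges of `Ω_δ` is not a discrete boundary
vertex. [folklore] -/
theorem not_mem_meshBoundary_of_forall_adj {x : Site 2}
    (hadj : ∀ k : Fin 4, (discreteDomainGraph Ω δ).Adj x (x + cornerUnit k)) :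
    x ∉ meshBoundary Ω δ := by
  rintro ⟨-, y, hxy, hny⟩
  obtain ⟨k, rfl⟩ := WeakBeurling.exists_eq_add_cornerUnit_of_adj hxy
  exact hny (hadj k)

open Classical in
/-- At a vertex all four of whose lattice edges are edges of `Ω_δ`, the harmonicity clause of a
potential (off the discrete arcs of `A` and `B`) is the vanishing of the lattice Laplacian.
[cite: GeorgakopoulosPanagiotis2019, §3.2] -/
theorem latticeLaplacian_eq_zero_of_forall_adj {A B : Set ℂ} {h : Site 2 → ℝ}
    (hharm : ∀ x, x ∉ discreteArc Ω δ A → x ∉ discreteArc Ω δ B →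
      ∑ y ∈ ((zdGraph 2).neighborFinset x).filter (fun y => (discreteDomainGraph Ω δ).Adj x y),
        (h y - h x) = 0)
    {x : Site 2} (hadj : ∀ k : Fin 4, (discreteDomainGraph Ω δ).Adj x (x + cornerUnit k)) :
    latticeLaplacian h x = 0 := by
  have hnotb := not_mem_meshBoundary_of_forall_adj hadj
  have hfilter : ((zdGraph 2).neighborFinset x).filter (fun y => (discreteDomainGraph Ω δ).Adj x y) =
      (zdGraph 2).neighborFinset x := by
    refine Finset.filter_true_of_mem fun y hy => ?_
    rw [SimpleGraph.mem_neighborFinset] at hy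
    obtain ⟨k, rfl⟩ := WeakBeurling.exists_eq_add_cornerUnit_of_adj hy
    exact hadj k
  have := hharm x (fun h => hnotb h.1) (fun h => hnotb h.1)
  rwa [hfilter, sum_neighborFinset_sub_eq_latticeLaplacian] at this

open Classical in
/-- **Interior harmonicity of the potential on a box of vertices of `Ω_δ`.** If the rescaled closed
square of a lattice box lies in `Ω` and all its lattice points are vertices of `Ω_δ`, a potential
harmonic for `Ω_δ` off the discrete arcs is lattice harmonic on the open box.
[cite: GeorgakopoulosPanagiotis2019, §4.1] -/
theorem isLatticeHarmonicOn_boxInterior_of_box (hδ : 0 < δ) {A B : Set ℂ} {h : Site 2 → ℝ}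
    (hharm : ∀ x, x ∉ discreteArc Ω δ A → x ∉ discreteArc Ω δ B →
      ∑ y ∈ ((zdGraph 2).neighborFinset x).filter (fun y => (discreteDomainGraph Ω δ).Adj x y),
        (h y - h x) = 0)
    {a : Site 2} {N : ℕ}
    (hΩ : Complex.Rectangle (meshPoint δ a) (meshPoint δ (a + ![(N : ℤ), (N : ℤ)])) ⊆ Ω)
    (hdom : ∀ x : Site 2,
      meshPoint δ x ∈ Complex.Rectangle (meshPoint δ a) (meshPoint δ (a + ![(N : ℤ), (N : ℤ)])) →
        x ∈ meshDomain Ω δ) :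
    IsLatticeHarmonicOn h (boxInterior a N) := fun _ hx =>
  latticeLaplacian_eq_zero_of_forall_adj hharm (discreteDomainGraph_adj_of_box hδ hΩ hdom hx)

open Classical in
/-- **Potentials of `Ω_δ` are harmonic on the boxes of a compact subset, for small meshes** (every
Jordan domain). For a compact `K ⊆ Ω = D.carrier` there is `δ₀ > 0` such that for `0 < δ < δ₀`
every `h` harmonic for `Ω_δ` off the discrete arcs of any `A`, `B` is lattice harmonic on the
interior of every lattice box whose rescaled closed square lies in `K` — because the lattice
points of `K` are vertices of `Ω_δ` (`MeshDomainJordan.lean`). [cite: GeorgakopoulosPanagiotis2019, §4.1] -/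
theorem exists_forall_isLatticeHarmonicOn_boxInterior (D : JordanDomain) {K : Set ℂ} (hK : IsCompact K)
    (hKΩ : K ⊆ D.carrier) :
    ∃ δ₀ > 0, ∀ δ, 0 < δ → δ < δ₀ → ∀ (A B : Set ℂ) (h : Site 2 → ℝ),
      (∀ x, x ∉ discreteArc D.carrier δ A → x ∉ discreteArc D.carrier δ B →
        ∑ y ∈ ((zdGraph 2).neighborFinset x).filter (fun y => (discreteDomainGraph D.carrier δ).Adj x y),
          (h y - h x) = 0) →
      ∀ (a : Site 2) (N : ℕ),
        Complex.Rectangle (meshPoint δ a) (meshPoint δ (a + ![(N : ℤ), (N : ℤ)])) ⊆ K →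
          IsLatticeHarmonicOn h (boxInterior a N) := by
  obtain ⟨δ₀, hδ₀, hdom⟩ := D.exists_forall_mem_meshDomain_and_reachable hK hKΩ
  refine ⟨δ₀, hδ₀, fun δ hδ hδlt A B h hharm a N hsq => ?_⟩
  exact isLatticeHarmonicOn_boxInterior_of_box hδ hharm (hsq.trans hKΩ)
    fun x hx => (hdom δ hδ hδlt).1 x (hsq hx)

/-! ### Lattice edges at the points of a compact subset -/

/-- **The four lattice edges at the lattice points of a compact `K ⊆ Ω` are edges of `Ω_δ` for
small meshes** (every Jordan domain). [cite: GeorgakopoulosPanagiotis2019, §4.1] -/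
theorem exists_forall_adj_of_mem (D : JordanDomain) {K : Set ℂ} (hK : IsCompact K)
    (hKΩ : K ⊆ D.carrier) :
    ∃ δ₀ > 0, ∀ δ, 0 < δ → δ < δ₀ → ∀ x : Site 2, meshPoint δ x ∈ K →
      ∀ k : Fin 4, (discreteDomainGraph D.carrier δ).Adj x (x + cornerUnit k) := by
  obtain ⟨ρ', hρ', hρ'Ω⟩ := hK.exists_cthickening_subset_open D.isOpen hKΩ
  obtain ⟨δ₁, hδ₁, hdom⟩ := D.exists_forall_mem_meshDomain_and_reachable (hK.cthickening (r := ρ')) hρ'Ω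
  refine ⟨min δ₁ ρ', by positivity, fun δ hδ hδlt x hx k => ?_⟩
  have hδ₁' : δ < δ₁ := hδlt.trans_le (min_le_left _ _)
  have hδρ : δ < ρ' := hδlt.trans_le (min_le_right _ _)
  have hsub : segment ℝ (meshPoint δ x) (meshPoint δ (x + cornerUnit k)) ⊆ cthickening ρ' K := by
    intro p hp
    refine Metric.mem_cthickening_of_dist_le p (meshPoint δ x) ρ' K hx ?_
    have hseg : segment ℝ (meshPoint δ x) (meshPoint δ (x + cornerUnit k)) ⊆ closedBall (meshPoint δ x) |δ| :=
      (convex_closedBall _ _).segment_subset (mem_closedBall_self (abs_nonneg _))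
        (by rw [mem_closedBall, _root_.dist_comm, Literature.Probability.Percolation.dist_meshPoint_of_adj (cSrc_mem_edgeSet (x, k))])
    have := hseg hp
    rw [mem_closedBall, abs_of_pos hδ] at this
    exact this.trans hδρ.le
  refine discreteDomainGraph_adj_iff.2 ⟨meshGraph_adj_iff.2 ⟨cSrc_mem_edgeSet (x, k), ?_⟩,
    (hdom δ hδ hδ₁').1 x (Metric.self_subset_cthickening _ hx),
    (hdom δ hδ hδ₁').1 _ (hsub (right_mem_segment ℝ _ _))⟩
  exact (hsub.trans hρ'Ω).trans subset_closure

/-- For a fixed point `w ∈ Ω` and meshes `δ' n → 0`, the lattice point nearest to `w` is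
eventually an interior vertex of `Ω_δ` (all four lattice edges at it are edges of `Ω_δ`).
[cite: GeorgakopoulosPanagiotis2019, §4.1] -/
theorem eventually_adj_nearestSite' (D : JordanDomain) {δ' : ℕ → ℝ} (hδ : ∀ n, 0 < δ' n)
    (hδ0 : Tendsto δ' atTop (𝓝 0)) {w : ℂ} (hw : w ∈ D.carrier) :
    ∀ᶠ n in atTop, ∀ kk : Fin 4,
      (discreteDomainGraph D.carrier (δ' n)).Adj (nearestSite (δ' n) w) (nearestSite (δ' n) w + cornerUnit kk) := by
  obtain ⟨s, hs, hsΩ⟩ := Metric.isOpen_iff.1 D.isOpen w hw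
  have hKΩ : closedBall w (s / 2) ⊆ D.carrier := (closedBall_subset_ball (by linarith)).trans hsΩ
  obtain ⟨δ₁, hδ₁, hadj⟩ := exists_forall_adj_of_mem D (isCompact_closedBall w (s / 2)) hKΩ
  filter_upwards [(tendsto_order.1 hδ0).2 _ (lt_min hδ₁ (show 0 < s / 2 by positivity))] with n hn kk
  have hn1 : δ' n < δ₁ := hn.trans_le (min_le_left _ _)
  have hn2 : δ' n < s / 2 := hn.trans_le (min_le_right _ _)
  refine hadj _ (hδ n) hn1 _ ?_ kk
  exact mem_closedBall.2 ((dist_meshPoint_nearestSite_le (hδ n) w).trans hn2.le)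

/-- **Axis edges at the lattice points of a compact subset are eventually edges of `Ω_δ`.**
[cite: GeorgakopoulosPanagiotis2019, §4.1] -/
theorem eventually_axisEdges_mem' (D : JordanDomain) {δ' : ℕ → ℝ} (hδ : ∀ n, 0 < δ' n)
    (hδ0 : Tendsto δ' atTop (𝓝 0)) {K' : Set ℂ} (hK'Ω : K' ⊆ D.carrier) (hK'c : IsCompact K') :
    ∀ᶠ n in atTop, ∀ x : Site 2, meshPoint (δ' n) x ∈ K' →
      ∀ i : Fin 2, s(x, x + (Pi.single i 1 : Site 2)) ∈ (discreteDomainGraph D.carrier (δ' n)).edgeSet := by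
  obtain ⟨δ₁, hδ₁, hadj⟩ := exists_forall_adj_of_mem D hK'c hK'Ω
  filter_upwards [(tendsto_order.1 hδ0).2 _ hδ₁] with n hn x hx i
  rw [SimpleGraph.mem_edgeSet, single_eq_cornerUnit_cast]
  exact hadj _ (hδ n) hn x hx _

end KirchhoffSlope

end Summit.CriticalPhenomena.CardyFormulaZ2.Theorems
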